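import Summits.AtomisticToContinuum.FouriersLaw.Theorems.BondHeatUncertaintyBoundedResponseThoulessWindowA

/-!
# NODE 106 «ThoulessWindow» — part B of 3 (sequel of `…ThoulessWindowA`): §3 the graded hypothesis `Prop`s, §4 door / ★ / necessity, §5 free rungs

Split for the 400-line cap by the landing lane (hand-2 g38) — 3-way cut at node l.300 / l.530 per lens-1 g106 probes/CHECKS-g106.md, approved by critic row 1463;
same namespace `…Theorems.BoundedResponse.HeatSpreading` and opens throughout; all FQNs unchanged; bodies verbatim.  See part A for the full header.  0 sorry; standard axioms.
-/

noncomputable section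

open MeasureTheory ProbabilityTheory Filter Topology Set Function
open scoped NNReal ENNReal
open Literature.MathematicalPhysics.KineticTheory.HeatConduction
open Literature.MathematicalPhysics.KineticTheory OscillatorChain
open Summit.AtomisticToContinuum.FouriersLaw.Theorems.SubdiffusiveBondHeat
open Summit.AtomisticToContinuum.FouriersLaw.Theorems.SubdiffusiveBondHeat.EscapeGrading
open Summit.AtomisticToContinuum.FouriersLaw.Theorems.OddSectorIrreversibility

namespace Summit.AtomisticToContinuum.FouriersLaw.Theorems.BoundedResponse.HeatSpreading

open Summit.AtomisticToContinuum.FouriersLaw.Theses.BondHeatUncertainty (BoundedResponse SubdiffusiveBondHeat)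
open Summit.AtomisticToContinuum.FouriersLaw.Theorems.BoundedResponse.ParityFloor (exists_integral_totalCurrent_sq_gibbsMeasure_le)

/-- `x ^ (3 : ℝ) = x ^ 3` — private twin of part A's `rpow_three_tw` (lane edit hand-2 g38: part A's copy took a `private` dedup token vs
`Literature…DimockYuan2024.FirstLinearEquation.rpow_three_eq`, and private declarations are invisible across the split; body verbatim). [formal bookkeeping] -/
private theorem rpow_three_tw (x : ℝ) : x ^ (3 : ℝ) = x ^ 3 := by
  rw [show (3 : ℝ) = ((3 : ℕ) : ℝ) by norm_num, Real.rpow_natCast]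

/-! ## §3 The graded pieces (hypothesis `Prop`s over the conjunct's parameters) -/

/-- **(LMᶜ_g) `LateMomentCeiling g`** — LATE FIRST MOMENT: `∃ a > 0 ∀ c > 0 ∃ C N₀ ∀ N ≥ N₀: M_N(aN, cN²) ≤ C·N^g`.  `g = 5` PROVED (free); `g = 3` the
pre-Thouless half of the residual.  Why it might fail (`g = 3`): a late positive surge of `C_N` in the window `[aN, cN²]` of total weight `≫ N` (it would not
contradict `G_N = O(N)` if compensated before `aN`).  Tags: WEAKER (⟸ PT_3 ∧ TTFloor_3) · UNDECIDED (`g < 5`) · phonon-compatible at `g = 3` (margin) ·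
INSTRUMENTABLE. [route statement · this cell; NOT a literature fact] -/
def LateMomentCeiling (g : ℝ) : Prop :=
  ∀ ω₂ lam β γ : ℝ, 0 < ω₂ → 0 < lam → 0 < β → 0 < γ → ∀ T : ℝ, 0 < T → ∃ a : ℝ, 0 < a ∧ ∀ c : ℝ, 0 < c →
    ∃ C : ℝ, ∃ N₀ : ℕ, ∀ N : ℕ, N₀ ≤ N → gkMoment ω₂ lam β γ T N (a * N) (c * (N : ℝ) ^ 2) ≤ C * (N : ℝ) ^ g

/-- **(TTᶜ_g) `ThoulessTailCeiling g`** — POST-THOULESS TAIL: `∀ c > 0 ∃ C N₀ ∀ N ≥ N₀: cN²·R_N(cN²) ≤ C·N^g`, i.e. the Green–Kubo integral still missing at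
the Thouless time is `≤ C·N^{g−2}/c`.  `g = 5` PROVED (free); `g = 3`: `R_N(cN²) = O(N)` — the post-Thouless half of the residual («diffusive relaxation has
finished exporting the current correlation by the Thouless time, to Ohmic accuracy»).  Why it might fail (`g = 3`): a slow (sub-gap) positive tail of `C_N`.
Tags: WEAKER (⟸ PT_3 ∧ LMFloor_3; ⟸ PTD/PTG) · UNDECIDED (`g < 5`) · phonon-compatible at `g = 3` (margin, echo cancellation) · INSTRUMENTABLE.
[route statement · this cell; NOT a literature fact] -/
def ThoulessTailCeiling (g : ℝ) : Prop :=
  ∀ ω₂ lam β γ : ℝ, 0 < ω₂ → 0 < lam → 0 < β → 0 < γ → ∀ T : ℝ, 0 < T → ∀ c : ℝ, 0 < c →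
    ∃ C : ℝ, ∃ N₀ : ℕ, ∀ N : ℕ, N₀ ≤ N → c * (N : ℝ) ^ 2 * gkRemainder ω₂ lam β γ T N (c * (N : ℝ) ^ 2) ≤ C * (N : ℝ) ^ g

/-- **(PTᶜ_g) `PostTransitCeiling g`** — the residual RE-LOCALISED past the light cone: `∀ a, c > 0 ∃ C N₀ ∀ N ≥ N₀: M_N(aN,cN²) + cN²·R_N(cN²) ≤ C·N^g`.
At `g = 3` EQUIVALENT to `GKTailCeiling 3` (★); not a new piece — the statement that the residual asks nothing before the transit time.
Tags: EQUIV · UNDECIDED · phonon-compatible (margin). [route statement · this cell; NOT a literature fact] -/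
def PostTransitCeiling (g : ℝ) : Prop :=
  ∀ ω₂ lam β γ : ℝ, 0 < ω₂ → 0 < lam → 0 < β → 0 < γ → ∀ T : ℝ, 0 < T → ∀ a c : ℝ, 0 < a → 0 < c →
    ∃ C : ℝ, ∃ N₀ : ℕ, ∀ N : ℕ, N₀ ≤ N →
      gkMoment ω₂ lam β γ T N (a * N) (c * (N : ℝ) ^ 2) + c * (N : ℝ) ^ 2 * gkRemainder ω₂ lam β γ T N (c * (N : ℝ) ^ 2) ≤
        C * (N : ℝ) ^ g

/-- **(LMᶠ_g) `LateMomentFloor g`** — `∃ a > 0 ∀ c > 0 ∃ C N₀ ∀ N ≥ N₀: −C·N^g ≤ M_N(aN,cN²)`; the mild floor that makes (TTᶜ_3) necessary for (PTᶜ_3)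
(`g = 5` free; `g = 3` TRUE-leaning, phonon-compatible). [route statement · this cell; NOT a literature fact] -/
def LateMomentFloor (g : ℝ) : Prop :=
  ∀ ω₂ lam β γ : ℝ, 0 < ω₂ → 0 < lam → 0 < β → 0 < γ → ∀ T : ℝ, 0 < T → ∃ a : ℝ, 0 < a ∧ ∀ c : ℝ, 0 < c →
    ∃ C : ℝ, ∃ N₀ : ℕ, ∀ N : ℕ, N₀ ≤ N → -(C * (N : ℝ) ^ g) ≤ gkMoment ω₂ lam β γ T N (a * N) (c * (N : ℝ) ^ 2)

/-- **(TTᶠ_g) `ThoulessTailFloor g`** — `∀ c > 0 ∃ C N₀ ∀ N ≥ N₀: −C·N^g ≤ cN²·R_N(cN²)`; the mild floor that makes (LMᶜ_3) necessary for (PTᶜ_3)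
(`g = 5` free; `g = 3` TRUE-leaning, phonon-compatible). [route statement · this cell; NOT a literature fact] -/
def ThoulessTailFloor (g : ℝ) : Prop :=
  ∀ ω₂ lam β γ : ℝ, 0 < ω₂ → 0 < lam → 0 < β → 0 < γ → ∀ T : ℝ, 0 < T → ∀ c : ℝ, 0 < c →
    ∃ C : ℝ, ∃ N₀ : ℕ, ∀ N : ℕ, N₀ ≤ N → -(C * (N : ℝ) ^ g) ≤ c * (N : ℝ) ^ 2 * gkRemainder ω₂ lam β γ T N (c * (N : ℝ) ^ 2)

/-- **(PTDᶜ_{p,α}) `PostTransitDecay p α`** — WINDOWED ALGEBRAIC DECAY of the one observable: `∃ a > 0, A, N₀: ∀ N ≥ N₀, ∀ s ≥ aN: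
|C_N(s)| ≤ A·N^p·s^{−α}`.  Nothing is asked on `[0, aN)` (not a costume of `G_N = O(N)`).  Seams: `1 < α < 2 ⟹ (LMᶜ, TTᶜ, TCᶜ at grade p + 4 − 2α)`;
grade 3 iff `p ≤ 2α − 1`.  Heuristic truth `(p,α) ≈ (0, 3/2)` (boundary energy imbalance, Robin tail); every grade-3 member is phonon-FALSE
(`|C_N^{harm}(aN)| ≍ N`).  Why it might fail: a ballistic / breather channel keeping `|C_N(s)| ≍ N^{α−1+ε}` at `s ≍ N` in some temperature window.
Tags: INCOMPARABLE with 11071 (sufficient jointly with (S); alone neither sufficient — `C_N` free before `aN` — nor necessary) · UNDECIDED ·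
ATTACKABLE (one-observable decay past the light cone) · INSTRUMENTABLE. [route statement · this cell; NOT a literature fact] -/
def PostTransitDecay (p α : ℝ) : Prop :=
  ∀ ω₂ lam β γ : ℝ, 0 < ω₂ → 0 < lam → 0 < β → 0 < γ → ∀ T : ℝ, 0 < T → ∃ a A : ℝ, 0 < a ∧ ∃ N₀ : ℕ, ∀ N : ℕ, N₀ ≤ N →
    ∀ s : ℝ, a * N ≤ s → |totalAutocorr ω₂ lam β γ T N s| ≤ A * (N : ℝ) ^ p * s ^ (-α)

/-- **(PTGᶜ_p) `PostTransitGapDecay p`** — WINDOWED DECAY AT THE DIFFUSIVE GAP RATE with amplitude `N^p`: `∃ a, κ > 0, A, N₀: ∀ N ≥ N₀, ∀ s ≥ aN: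
|C_N(s)| ≤ A·N^p·exp(−(κ/N²)·s)`.  No spectral gap is typed (one autocorrelation, one window).  Seam: `⟹ TCᶜ_{max(3, p+4)}`; grade 3 iff `p ≤ −1`
(amplitude `1/N` at the transit time).  Heuristically TRUE-leaning at `p = −1` (truth `≈ s^{−3/2}·1 ≤ N^{−3/2}` at `s = aN`), phonon-FALSE.  Why it might
fail: the slow part of `C_N` past the transit time exceeds the hydrodynamic prediction — `|C_N(aN)| ≳ N^{−1+ε}` because boundary-layer (contact)
relaxation slows with `N`, or a ballistic channel survives to `s ≍ N`.  Tags: INCOMPARABLE with 11071 (as (PTD)) · UNDECIDED · IDEA-NEEDED (amplitude) ·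
INSTRUMENTABLE. [route statement · this cell; NOT a literature fact] -/
def PostTransitGapDecay (p : ℝ) : Prop :=
  ∀ ω₂ lam β γ : ℝ, 0 < ω₂ → 0 < lam → 0 < β → 0 < γ → ∀ T : ℝ, 0 < T → ∃ a A κ : ℝ, 0 < a ∧ 0 < κ ∧ ∃ N₀ : ℕ, ∀ N : ℕ, N₀ ≤ N →
    ∀ s : ℝ, a * N ≤ s → |totalAutocorr ω₂ lam β γ T N s| ≤ A * (N : ℝ) ^ p * Real.exp (-(κ / (N : ℝ) ^ 2) * s)

/-! ## §4 The door: early moment free, ★ `TC_3 ⟺ PT_3`, sufficiency and necessity of the two halves -/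

/-- **SUFFICIENCY `LM_g ∧ TT_{g'} ⟹ TC_{max(3,g,g')}`**: the split at `t₁ = aN`, `t₂ = cN²` with the free early moment `≤ (C_J a²/2)·N³`. [folklore] -/
theorem gkTailCeiling_of_lateMoment_thoulessTail {g g' : ℝ} (hL : LateMomentCeiling g) (hR : ThoulessTailCeiling g') :
    GKTailCeiling (max 3 (max g g')) := by
  intro ω₂ lam β γ hω hl hβ hγ T hT c hc
  obtain ⟨a, ha, hLa⟩ := hL ω₂ lam β γ hω hl hβ hγ T hT
  obtain ⟨C₁, N₁, hC₁⟩ := hLa c hc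
  obtain ⟨C₂, N₂, hC₂⟩ := hR ω₂ lam β γ hω hl hβ hγ T hT c hc
  obtain ⟨CJ, hCJ0, hJ⟩ := exists_integral_totalCurrent_sq_gibbsMeasure_le (γ := γ) hω hl hβ hT
  refine ⟨max (CJ * a ^ 2 / 2) 0 + max C₁ 0 + max C₂ 0, max (max N₁ N₂) (max 1 ⌈a / c⌉₊), fun N hN => ?_⟩
  have hN₁ : N₁ ≤ N := le_trans (le_trans (le_max_left _ _) (le_max_left _ _)) hN
  have hN₂ : N₂ ≤ N := le_trans (le_trans (le_max_right _ _) (le_max_left _ _)) hN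
  have hN1 : 1 ≤ N := le_trans (le_trans (le_max_left _ _) (le_max_right _ _)) hN
  have hNc : ⌈a / c⌉₊ ≤ N := le_trans (le_trans (le_max_right _ _) (le_max_right _ _)) hN
  have hN0 : 0 < N := by omega
  have hNr : (1 : ℝ) ≤ N := by exact_mod_cast hN1
  have haN : 0 ≤ a * (N : ℝ) := by positivity
  have hwin := window_le_tw hc hNc
  rw [gkTail_eq_early_add_late_add_tail hω hl hβ hγ hT hN0 haN hwin]
  have hE : gkMoment ω₂ lam β γ T N 0 (a * N) ≤ CJ * a ^ 2 / 2 * (N : ℝ) ^ (3 : ℝ) := by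
    have h1 := (abs_le.1 (abs_gkMoment_le hω hl hβ hγ hT hN0 le_rfl haN)).2
    have h2 : (0 : ℝ) ≤ ((a * N) ^ 2 - 0 ^ 2) / 2 := by
      rw [zero_pow two_ne_zero, sub_zero]
      positivity
    rw [rpow_three_tw]
    calc gkMoment ω₂ lam β γ T N 0 (a * N) ≤ _ := h1
      _ ≤ CJ * (N : ℝ) * (((a * N) ^ 2 - 0 ^ 2) / 2) := mul_le_mul_of_nonneg_right (hJ N) h2
      _ = CJ * a ^ 2 / 2 * (N : ℝ) ^ 3 := by ring
  have h3 : (3 : ℝ) ≤ max 3 (max g g') := le_max_left _ _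
  have hg : g ≤ max 3 (max g g') := le_trans (le_max_left _ _) (le_max_right _ _)
  have hg' : g' ≤ max 3 (max g g') := le_trans (le_max_right _ _) (le_max_right _ _)
  have i1 := hE.trans (mul_rpow_le_max_mul_rpow_tw hNr h3)
  have i2 := (hC₁ N hN₁).trans (mul_rpow_le_max_mul_rpow_tw hNr hg)
  have i3 := (hC₂ N hN₂).trans (mul_rpow_le_max_mul_rpow_tw hNr hg')
  calc _ ≤ max (CJ * a ^ 2 / 2) 0 * (N : ℝ) ^ max 3 (max g g') + max C₁ 0 * (N : ℝ) ^ max 3 (max g g') +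
        max C₂ 0 * (N : ℝ) ^ max 3 (max g g') := add_le_add (add_le_add i1 i2) i3
    _ = (max (CJ * a ^ 2 / 2) 0 + max C₁ 0 + max C₂ 0) * (N : ℝ) ^ max 3 (max g g') := by ring

/-- **`LM_3 ∧ TT_3 ⟹ TC_3`** (the residual from its two halves). [folklore] -/
theorem gkTailCeiling_three_of_lateMoment_thoulessTail (hL : LateMomentCeiling 3) (hR : ThoulessTailCeiling 3) : GKTailCeiling 3 := by
  have h := gkTailCeiling_of_lateMoment_thoulessTail hL hR
  rwa [max_self, max_self] at h

/-- **★ `GKTailCeiling 3 ⟺ PostTransitCeiling 3`**: the residual of record asks nothing before the transit time. [folklore] -/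
theorem gkTailCeiling_three_iff_postTransitCeiling_three : GKTailCeiling 3 ↔ PostTransitCeiling 3 := by
  constructor
  · intro hC ω₂ lam β γ hω hl hβ hγ T hT a c ha hc
    obtain ⟨C, N₀, hCN⟩ := hC ω₂ lam β γ hω hl hβ hγ T hT c hc
    obtain ⟨CJ, hCJ0, hJ⟩ := exists_integral_totalCurrent_sq_gibbsMeasure_le (γ := γ) hω hl hβ hT
    refine ⟨C + CJ * a ^ 2 / 2, max N₀ (max 1 ⌈a / c⌉₊), fun N hN => ?_⟩
    have hN₀ : N₀ ≤ N := le_trans (le_max_left _ _) hN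
    have hN1 : 1 ≤ N := le_trans (le_trans (le_max_left _ _) (le_max_right _ _)) hN
    have hNc : ⌈a / c⌉₊ ≤ N := le_trans (le_trans (le_max_right _ _) (le_max_right _ _)) hN
    have hN0 : 0 < N := by omega
    have haN : 0 ≤ a * (N : ℝ) := by positivity
    have hwin := window_le_tw hc hNc
    have hsplit := gkTail_eq_early_add_late_add_tail hω hl hβ hγ hT hN0 haN hwin
    have h1 := (abs_le.1 (abs_gkMoment_le hω hl hβ hγ hT hN0 le_rfl haN)).1
    have h2 : (0 : ℝ) ≤ ((a * N) ^ 2 - 0 ^ 2) / 2 := by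
      rw [zero_pow two_ne_zero, sub_zero]
      positivity
    have hE : -(CJ * a ^ 2 / 2 * (N : ℝ) ^ 3) ≤ gkMoment ω₂ lam β γ T N 0 (a * N) := by
      have := mul_le_mul_of_nonneg_right (hJ N) h2
      have e : CJ * (N : ℝ) * (((a * N) ^ 2 - 0 ^ 2) / 2) = CJ * a ^ 2 / 2 * (N : ℝ) ^ 3 := by ring
      linarith
    have hT3 := hCN N hN₀
    rw [rpow_three_tw] at hT3 ⊢
    linarith
  · intro hP ω₂ lam β γ hω hl hβ hγ T hT c hc
    obtain ⟨C, N₀, hCN⟩ := hP ω₂ lam β γ hω hl hβ hγ T hT 1 c one_pos hc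
    obtain ⟨CJ, hCJ0, hJ⟩ := exists_integral_totalCurrent_sq_gibbsMeasure_le (γ := γ) hω hl hβ hT
    refine ⟨C + CJ / 2, max N₀ (max 1 ⌈1 / c⌉₊), fun N hN => ?_⟩
    have hN₀ : N₀ ≤ N := le_trans (le_max_left _ _) hN
    have hN1 : 1 ≤ N := le_trans (le_trans (le_max_left _ _) (le_max_right _ _)) hN
    have hNc : ⌈1 / c⌉₊ ≤ N := le_trans (le_trans (le_max_right _ _) (le_max_right _ _)) hN
    have hN0 : 0 < N := by omega
    have haN : 0 ≤ 1 * (N : ℝ) := by positivity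
    have hwin := window_le_tw hc hNc
    rw [gkTail_eq_early_add_late_add_tail hω hl hβ hγ hT hN0 haN hwin]
    have h1 := (abs_le.1 (abs_gkMoment_le hω hl hβ hγ hT hN0 le_rfl haN)).2
    have h2 : (0 : ℝ) ≤ ((1 * N) ^ 2 - 0 ^ 2) / 2 := by
      rw [zero_pow two_ne_zero, sub_zero]
      positivity
    have hE : gkMoment ω₂ lam β γ T N 0 (1 * N) ≤ CJ / 2 * (N : ℝ) ^ 3 := by
      have := mul_le_mul_of_nonneg_right (hJ N) h2
      have e : CJ * (N : ℝ) * (((1 * (N : ℝ)) ^ 2 - 0 ^ 2) / 2) = CJ / 2 * (N : ℝ) ^ 3 := by ring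
      linarith
    have hT3 := hCN N hN₀
    rw [rpow_three_tw] at hT3 ⊢
    have hadd : gkMoment ω₂ lam β γ T N 0 (1 * ↑N) + gkMoment ω₂ lam β γ T N (1 * ↑N) (c * ↑N ^ 2) +
        c * ↑N ^ 2 * gkRemainder ω₂ lam β γ T N (c * ↑N ^ 2) ≤ CJ / 2 * ↑N ^ 3 + C * ↑N ^ 3 := by linarith
    linarith

/-- **`11071 ⟹ PT_3`** (tree: `gkTailCeiling_three_of_boundedResponse`, and ★). [folklore] -/
theorem postTransitCeiling_three_of_boundedResponse (hB : BoundedResponse) : PostTransitCeiling 3 :=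
  gkTailCeiling_three_iff_postTransitCeiling_three.1 (gkTailCeiling_three_of_boundedResponse hB)

/-- **NECESSITY of the late-moment half modulo the tail floor: `PT_3 ∧ TTFloor_3 ⟹ LM_3`.** [folklore] -/
theorem lateMomentCeiling_three_of_postTransit_tailFloor (hP : PostTransitCeiling 3) (hF : ThoulessTailFloor 3) : LateMomentCeiling 3 := by
  intro ω₂ lam β γ hω hl hβ hγ T hT
  refine ⟨1, one_pos, fun c hc => ?_⟩
  obtain ⟨C, N₀, hCN⟩ := hP ω₂ lam β γ hω hl hβ hγ T hT 1 c one_pos hc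
  obtain ⟨C', N₀', hCN'⟩ := hF ω₂ lam β γ hω hl hβ hγ T hT c hc
  refine ⟨C + C', max N₀ N₀', fun N hN => ?_⟩
  have h1 := hCN N (le_trans (le_max_left _ _) hN)
  have h2 := hCN' N (le_trans (le_max_right _ _) hN)
  linarith

/-- **NECESSITY of the tail half modulo the late-moment floor: `PT_3 ∧ LMFloor_3 ⟹ TT_3`.** [folklore] -/
theorem thoulessTailCeiling_three_of_postTransit_momentFloor (hP : PostTransitCeiling 3) (hF : LateMomentFloor 3) : ThoulessTailCeiling 3 := by
  intro ω₂ lam β γ hω hl hβ hγ T hT c hc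
  obtain ⟨a, ha, hFa⟩ := hF ω₂ lam β γ hω hl hβ hγ T hT
  obtain ⟨C', N₀', hCN'⟩ := hFa c hc
  obtain ⟨C, N₀, hCN⟩ := hP ω₂ lam β γ hω hl hβ hγ T hT a c ha hc
  refine ⟨C + C', max N₀ N₀', fun N hN => ?_⟩
  have h1 := hCN N (le_trans (le_max_left _ _) hN)
  have h2 := hCN' N (le_trans (le_max_right _ _) hN)
  linarith

/-- **With (S): `SubdiffusiveBondHeat ∧ LM_3 ∧ TT_3 ⟹ BoundedResponse`** (NODE 105 door `boundedResponse_of_subdiffusiveBondHeat_gkTailCeiling_three`).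
[folklore] -/
theorem boundedResponse_of_subdiffusiveBondHeat_lateMoment_thoulessTail (hS : SubdiffusiveBondHeat) (hL : LateMomentCeiling 3)
    (hR : ThoulessTailCeiling 3) : BoundedResponse :=
  boundedResponse_of_subdiffusiveBondHeat_gkTailCeiling_three hS (gkTailCeiling_three_of_lateMoment_thoulessTail hL hR)

/-! ## §5 The free rungs `LM_5`, `TT_5` -/

/-- **(LMᶜ_5) PROVED** — `M_N(N, cN²) ≤ C_J N (cN²)²/2 = (C_J c²/2)·N⁵` (`a = 1`). [folklore] -/
theorem lateMomentCeiling_five : LateMomentCeiling 5 := by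
  intro ω₂ lam β γ hω hl hβ hγ T hT
  obtain ⟨CJ, hCJ0, hJ⟩ := exists_integral_totalCurrent_sq_gibbsMeasure_le (γ := γ) hω hl hβ hT
  refine ⟨1, one_pos, fun c hc => ⟨CJ * c ^ 2 / 2, max 1 ⌈1 / c⌉₊, fun N hN => ?_⟩⟩
  have hN1 : 1 ≤ N := le_trans (le_max_left _ _) hN
  have hNc : ⌈1 / c⌉₊ ≤ N := le_trans (le_max_right _ _) hN
  have hN0 : 0 < N := by omega
  have haN : 0 ≤ 1 * (N : ℝ) := by positivity
  have hwin := window_le_tw hc hNc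
  have h1 := (abs_le.1 (abs_gkMoment_le hω hl hβ hγ hT hN0 haN hwin)).2
  have h2 : ((c * (N : ℝ) ^ 2) ^ 2 - (1 * (N : ℝ)) ^ 2) / 2 ≤ (c * (N : ℝ) ^ 2) ^ 2 / 2 := by nlinarith [sq_nonneg (N : ℝ)]
  have h3 : (0 : ℝ) ≤ ((c * (N : ℝ) ^ 2) ^ 2 - (1 * (N : ℝ)) ^ 2) / 2 := by nlinarith
  rw [rpow_five_tw]
  calc gkMoment ω₂ lam β γ T N (1 * N) (c * (N : ℝ) ^ 2) ≤ _ := h1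
    _ ≤ CJ * (N : ℝ) * (((c * (N : ℝ) ^ 2) ^ 2 - (1 * (N : ℝ)) ^ 2) / 2) := mul_le_mul_of_nonneg_right (hJ N) h3
    _ ≤ CJ * (N : ℝ) * ((c * (N : ℝ) ^ 2) ^ 2 / 2) := mul_le_mul_of_nonneg_left h2 (by positivity)
    _ = CJ * c ^ 2 / 2 * (N : ℝ) ^ 5 := by ring

/-- **(TTᶜ_5) PROVED** — `cN²·R_N(cN²) ≤ cN²(γT²(N−1)² + C_J N·cN²) ≤ (cγT² + C_J c²)·N⁵` (`N ≥ 2`). [folklore] -/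
theorem thoulessTailCeiling_five : ThoulessTailCeiling 5 := by
  intro ω₂ lam β γ hω hl hβ hγ T hT c hc
  obtain ⟨CJ, hCJ0, hJ⟩ := exists_integral_totalCurrent_sq_gibbsMeasure_le (γ := γ) hω hl hβ hT
  refine ⟨c * γ * T ^ 2 + CJ * c ^ 2, 2, fun N hN => ?_⟩
  have hNr : (2 : ℝ) ≤ N := by exact_mod_cast hN
  have ht : (0 : ℝ) ≤ c * (N : ℝ) ^ 2 := by positivity
  have hR := (gkRemainder_bounds hω hl hβ hγ hT hN ht).2
  have h1 : ((N : ℝ) - 1) ^ 2 ≤ (N : ℝ) ^ 2 := by nlinarith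
  rw [rpow_five_tw]
  calc c * (N : ℝ) ^ 2 * gkRemainder ω₂ lam β γ T N (c * (N : ℝ) ^ 2)
        ≤ c * (N : ℝ) ^ 2 * (γ * T ^ 2 * ((N : ℝ) - 1) ^ 2 + CJ * (N : ℝ) * (c * (N : ℝ) ^ 2)) := by
          refine mul_le_mul_of_nonneg_left (hR.trans ?_) ht
          exact add_le_add le_rfl (mul_le_mul_of_nonneg_right (hJ N) ht)
    _ ≤ c * (N : ℝ) ^ 2 * (γ * T ^ 2 * (N : ℝ) ^ 2 + CJ * (N : ℝ) * (c * (N : ℝ) ^ 2)) := by gcongr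
    _ = c * γ * T ^ 2 * (N : ℝ) ^ 4 + CJ * c ^ 2 * (N : ℝ) ^ 5 := by ring
    _ ≤ c * γ * T ^ 2 * (N : ℝ) ^ 5 + CJ * c ^ 2 * (N : ℝ) ^ 5 := by
          have h4 : (N : ℝ) ^ 4 ≤ (N : ℝ) ^ 5 := pow_le_pow_right₀ (by linarith) (by norm_num)
          have h5 : 0 ≤ c * γ * T ^ 2 := by positivity
          nlinarith
    _ = (c * γ * T ^ 2 + CJ * c ^ 2) * (N : ℝ) ^ 5 := by ring


end Summit.AtomisticToContinuum.FouriersLaw.Theorems.BoundedResponse.HeatSpreading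

end
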